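import Mathlib.Combinatorics.SetFamily.Compression.Down
import Mathlib.Tactic
import HarnessLib
import HarnessLib.Audit.Tags
import Summits.CriticalPhenomena.PercolationContinuityZ3.Theorems.PercNearOneGluingNoHeavyLowerTailSahiRainbowTwoColourDeficitDefs

/-!
# The two-colouring statement for THREE antipodal pairs (`#Z = 6`): at least three monochromatic meets

Support file (seat `prim-masterthm-p1`, gen 42; `--supports stmt-CriticalPhenomena-4575`).  No `sorry`, standard axioms.

SETTING (`…SahiRainbowTwoColour`): `Z = X ⊔ Y ⊆ 2^G` complement-closed, `L = monoMeets X Y` (`∅` and the meets of distinct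
same-coloured members).  `SmallTwoColourMeets` (`…TwoColourTwinPoint`) is the two-colouring inequality `#Z ≤ 2 · #L` for
`#Z ∈ {6, 8}`; after `…TwoColourDeficitFinal` (`sparseTwinPoint`) it is ALL that the rainbow lemma `RainbowMeetCojoin` and the
three-family inequality M3♯ (`TwoColourMeets`) still rest on.

THIS FILE: the case lemmas for `#Z = 6` (three antipodal pairs `{a, G∖a}`, `{b, G∖b}`, `{c, G∖c}`; the assembly
`three_le_card_monoMeets_six` is the companion file `…TwoColourSmallThree`).  Cases by the colour types of the pairs: two constant pairs of one colour (the four quadrants, `three_le_quad`); one constant pair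
of each colour and a split pair (`three_le_t2`); one constant pair and two split pairs (`three_le_t1`); three split pairs = the
rainbow configuration of three sets (`three_le_t0`).  In each case two DISJOINT non-empty colours are exhibited (`three_le_of_disjoint`)
or two distinct non-empty colours directly.
HONEST FRAMING: unconditional elementary lemmas. [this work]
-/

namespace Summit.CriticalPhenomena.PercolationContinuityZ3.Theorems.SahiColouredDaykin

open Finset
open scoped FinsetFamily

variable {α : Type*} [DecidableEq α]

section Small3

variable {X Y : Finset (Finset α)} {G : Finset α}

/-- Two non-empty disjoint colours give, with `∅`, three colours. [this work] -/
theorem three_le_of_disjoint {s t : Finset α} (hs : s ∈ monoMeets X Y) (ht : t ∈ monoMeets X Y) (hsn : s.Nonempty)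
    (htn : t.Nonempty) (hst : Disjoint s t) : 3 ≤ #(monoMeets X Y) := by
  have hst' : s ≠ t := fun e => by
    obtain ⟨x, hx⟩ := hsn; exact disjoint_left.1 hst hx (e ▸ hx)
  have h0s : (∅ : Finset α) ≠ s := fun e => Finset.not_nonempty_empty (e ▸ hsn)
  have h0t : (∅ : Finset α) ≠ t := fun e => Finset.not_nonempty_empty (e ▸ htn)
  have hsub : ({∅, s, t} : Finset (Finset α)) ⊆ monoMeets X Y := by
    intro w hw
    simp only [mem_insert, mem_singleton] at hw
    rcases hw with rfl | rfl | rfl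
    exacts [empty_mem_monoMeets X Y, hs, ht]
  have : #({∅, s, t} : Finset (Finset α)) = 3 := by
    rw [card_insert_of_notMem, card_pair hst']
    simp only [mem_insert, mem_singleton, not_or]; exact ⟨h0s, h0t⟩
  exact this ▸ card_le_card hsub

/-- Two distinct non-empty colours give, with `∅`, three colours. [this work] -/
theorem three_le_of_ne {s t : Finset α} (hs : s ∈ monoMeets X Y) (ht : t ∈ monoMeets X Y) (hsn : s.Nonempty)
    (htn : t.Nonempty) (hst : s ≠ t) : 3 ≤ #(monoMeets X Y) := by
  have h0s : (∅ : Finset α) ≠ s := fun e => Finset.not_nonempty_empty (e ▸ hsn)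
  have h0t : (∅ : Finset α) ≠ t := fun e => Finset.not_nonempty_empty (e ▸ htn)
  have hsub : ({∅, s, t} : Finset (Finset α)) ⊆ monoMeets X Y := by
    intro w hw
    simp only [mem_insert, mem_singleton] at hw
    rcases hw with rfl | rfl | rfl
    exacts [empty_mem_monoMeets X Y, hs, ht]
  have : #({∅, s, t} : Finset (Finset α)) = 3 := by
    rw [card_insert_of_notMem, card_pair hst]
    simp only [mem_insert, mem_singleton, not_or]; exact ⟨h0s, h0t⟩
  exact this ▸ card_le_card hsub

/-- A set and a point split of it: if `s = u ∪ v` with `s` non-empty then `u` or `v` is non-empty. [this work] -/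
theorem nonempty_or_of_subset_union {s u v : Finset α} (hs : s.Nonempty) (h : s ⊆ u ∪ v) : u.Nonempty ∨ v.Nonempty := by
  obtain ⟨x, hx⟩ := hs
  rcases mem_union.1 (h hx) with h' | h'
  exacts [Or.inl ⟨x, h'⟩, Or.inr ⟨x, h'⟩]

/-- **Two constant pairs of one colour** (`a, G∖a, b, G∖b ∈ X`, distinct pairs): the four quadrants give two disjoint
non-empty colours. [this work] -/
theorem three_le_quad {a b : Finset α} (ha : a ∈ X) (ha' : G \ a ∈ X) (hb : b ∈ X) (hb' : G \ b ∈ X) (haG : a ⊆ G)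
    (hbG : b ⊆ G) (hab : a ≠ b) (hab' : a ≠ G \ b) : 3 ≤ #(monoMeets X Y) := by
  have hba' : G \ a ≠ b := fun e => hab' (by rw [← e, Finset.sdiff_sdiff_eq_self haG])
  have haa : G \ a ≠ G \ b := fun e => hab (by
    rw [← Finset.sdiff_sdiff_eq_self haG, e, Finset.sdiff_sdiff_eq_self hbG])
  have q1 : a ∩ b ∈ monoMeets X Y := inter_mem_monoMeets_left ha hb hab
  have q2 : a ∩ (G \ b) ∈ monoMeets X Y := inter_mem_monoMeets_left ha hb' hab'
  have q3 : (G \ a) ∩ b ∈ monoMeets X Y := inter_mem_monoMeets_left ha' hb hba'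
  have q4 : (G \ a) ∩ (G \ b) ∈ monoMeets X Y := inter_mem_monoMeets_left ha' hb' haa
  have cover : ∀ s : Finset α, s ⊆ G → s ⊆ s ∩ b ∪ s ∩ (G \ b) := by
    intro s hsG x hx
    by_cases hxb : x ∈ b
    · exact mem_union_left _ (mem_inter.2 ⟨hx, hxb⟩)
    · exact mem_union_right _ (mem_inter.2 ⟨hx, mem_sdiff.2 ⟨hsG hx, hxb⟩⟩)
  by_cases ha0 : a.Nonempty
  · by_cases ha1 : (G \ a).Nonempty
    · -- a non-empty quadrant inside `a` and one inside `G ∖ a`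
      have dj : ∀ {u v : Finset α}, u ⊆ a → v ⊆ G \ a → Disjoint u v := by
        intro u v hu hv; exact disjoint_of_subset_left hu (disjoint_of_subset_right hv disjoint_sdiff)
      rcases nonempty_or_of_subset_union ha0 (cover a haG) with h | h <;>
        rcases nonempty_or_of_subset_union ha1 (cover (G \ a) sdiff_subset) with h' | h'
      · exact three_le_of_disjoint q1 q3 h h' (dj inter_subset_left inter_subset_left)
      · exact three_le_of_disjoint q1 q4 h h' (dj inter_subset_left inter_subset_left)
      · exact three_le_of_disjoint q2 q3 h h' (dj inter_subset_left inter_subset_left)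
      · exact three_le_of_disjoint q2 q4 h h' (dj inter_subset_left inter_subset_left)
    · -- `a = G`: the quadrants `b` and `G ∖ b`
      rw [not_nonempty_iff_eq_empty, sdiff_eq_empty_iff_subset] at ha1
      have haG' : a = G := Subset.antisymm haG ha1
      rw [haG', inter_eq_right.2 hbG] at q1
      rw [haG', inter_eq_right.2 sdiff_subset] at q2
      have hb0 : b.Nonempty := by
        rw [nonempty_iff_ne_empty]; rintro rfl
        exact hab' (by rw [haG', sdiff_empty])
      have hb1 : (G \ b).Nonempty := by
        rw [nonempty_iff_ne_empty, Ne, sdiff_eq_empty_iff_subset]; intro h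
        exact hab (by rw [haG']; exact (Subset.antisymm hbG h).symm)
      exact three_le_of_disjoint q1 q2 hb0 hb1 disjoint_sdiff
  · -- `a = ∅`: the quadrants `b` and `G ∖ b` again
    rw [not_nonempty_iff_eq_empty] at ha0
    rw [ha0, sdiff_empty, inter_eq_right.2 hbG] at q3
    rw [ha0, sdiff_empty, inter_eq_right.2 sdiff_subset] at q4
    have hb0 : b.Nonempty := by rw [nonempty_iff_ne_empty]; rintro rfl; exact hab ha0
    have hb1 : (G \ b).Nonempty := by
      rw [nonempty_iff_ne_empty, Ne, sdiff_eq_empty_iff_subset]; intro h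
      exact hab' (by rw [ha0, (Subset.antisymm hbG h), Finset.sdiff_self])
    exact three_le_of_disjoint q3 q4 hb0 hb1 disjoint_sdiff

/-- The same for the second class. [this work] -/
theorem three_le_quad' {a b : Finset α} (ha : a ∈ Y) (ha' : G \ a ∈ Y) (hb : b ∈ Y) (hb' : G \ b ∈ Y) (haG : a ⊆ G)
    (hbG : b ⊆ G) (hab : a ≠ b) (hab' : a ≠ G \ b) : 3 ≤ #(monoMeets X Y) := by
  rw [monoMeets_comm]; exact three_le_quad ha ha' hb hb' haG hbG hab hab'

/-- A non-empty member `c` of the class of a constant pair `{a, G∖a}` has a non-empty quadrant `a ∩ c` or `(G∖a) ∩ c`,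
which is a colour. [this work] -/
theorem exists_piece {a c : Finset α} (ha : a ∈ X) (ha' : G \ a ∈ X) (hc : c ∈ X) (hcG : c ⊆ G) (hca : c ≠ a)
    (hca' : c ≠ G \ a) (hc0 : c.Nonempty) :
    ∃ w ∈ monoMeets X Y, w.Nonempty ∧ w ⊆ c ∧ (w = a ∩ c ∨ w = (G \ a) ∩ c) := by
  have q1 : a ∩ c ∈ monoMeets X Y := inter_mem_monoMeets_left ha hc hca.symm
  have q2 : (G \ a) ∩ c ∈ monoMeets X Y := inter_mem_monoMeets_left ha' hc hca'.symm
  have cover : c ⊆ a ∩ c ∪ (G \ a) ∩ c := by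
    intro x hx
    by_cases hxa : x ∈ a
    · exact mem_union_left _ (mem_inter.2 ⟨hxa, hx⟩)
    · exact mem_union_right _ (mem_inter.2 ⟨mem_sdiff.2 ⟨hcG hx, hxa⟩, hx⟩)
  rcases nonempty_or_of_subset_union hc0 cover with h | h
  · exact ⟨_, q1, h, inter_subset_right, Or.inl rfl⟩
  · exact ⟨_, q2, h, inter_subset_right, Or.inr rfl⟩

/-- **One constant pair of each colour and a split pair** (`a, G∖a ∈ X`; `b, G∖b ∈ Y`; `c ∈ X`, `G∖c ∈ Y`). [this work] -/
theorem three_le_t2 (hXY : Disjoint X Y) {a b c : Finset α} (ha : a ∈ X) (ha' : G \ a ∈ X) (hb : b ∈ Y)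
    (hb' : G \ b ∈ Y) (hc : c ∈ X) (hc' : G \ c ∈ Y) (haG : a ⊆ G) (hbG : b ⊆ G) (hcG : c ⊆ G) (hca : c ≠ a)
    (hca' : c ≠ G \ a) (hcb : G \ c ≠ b) (hcb' : G \ c ≠ G \ b) : 3 ≤ #(monoMeets X Y) := by
  have neXY : ∀ {s t : Finset α}, s ∈ X → t ∈ Y → s ≠ t := fun hs ht e => disjoint_left.1 hXY hs (e ▸ ht)
  by_cases hc0 : c.Nonempty
  · by_cases hc1 : (G \ c).Nonempty
    · obtain ⟨w, hw, hwn, hwc, -⟩ := exists_piece (Y := Y) ha ha' hc hcG hca hca' hc0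
      obtain ⟨w', hw', hwn', hwc', -⟩ := exists_piece (X := Y) (Y := X) hb hb' hc' sdiff_subset hcb hcb' hc1
      rw [monoMeets_comm] at hw'
      exact three_le_of_disjoint hw hw' hwn hwn'
        (disjoint_of_subset_left hwc (disjoint_of_subset_right hwc' disjoint_sdiff))
    · -- `c = G`: the colours `a` and `G ∖ a`
      have hcG' : c = G := Subset.antisymm hcG (sdiff_eq_empty_iff_subset.1 (not_nonempty_iff_eq_empty.1 hc1))
      have hce : G \ c = ∅ := by rw [hcG', Finset.sdiff_self]
      have q1 := inter_mem_monoMeets_left (Y := Y) ha hc hca.symm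
      have q2 := inter_mem_monoMeets_left (Y := Y) ha' hc hca'.symm
      rw [hcG', inter_eq_left.2 haG] at q1
      rw [hcG', inter_eq_left.2 sdiff_subset] at q2
      have ha0 : a.Nonempty := nonempty_iff_ne_empty.2 (fun e => neXY ha hc' (e.trans hce.symm))
      have ha1 : (G \ a).Nonempty := nonempty_iff_ne_empty.2 (fun e => neXY ha' hc' (e.trans hce.symm))
      exact three_le_of_disjoint q1 q2 ha0 ha1 disjoint_sdiff
  · -- `c = ∅`: the colours `b` and `G ∖ b`
    have hc0' : c = ∅ := not_nonempty_iff_eq_empty.1 hc0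
    have hcG' : G \ c = G := by rw [hc0', sdiff_empty]
    have q1 := inter_mem_monoMeets_right (X := X) hb hc' (Ne.symm hcb)
    have q2 := inter_mem_monoMeets_right (X := X) hb' hc' (Ne.symm hcb')
    rw [hcG', inter_eq_left.2 hbG] at q1
    rw [hcG', inter_eq_left.2 sdiff_subset] at q2
    have hb0 : b.Nonempty := nonempty_iff_ne_empty.2 (fun e => neXY hc hb (hc0'.trans e.symm))
    have hb1 : (G \ b).Nonempty := nonempty_iff_ne_empty.2 (fun e => neXY hc hb' (hc0'.trans e.symm))
    exact three_le_of_disjoint q1 q2 hb0 hb1 disjoint_sdiff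

/-- Core of the one-constant-pair case: `s, G∖s ∈ X` constant, `b, c ∈ X` the halves of two split pairs, with the SAME
non-empty quadrant `s ∩ b = s ∩ c`. [this work] -/
theorem three_le_t1_core {s b c : Finset α} (hs' : G \ s ∈ X) (hb : b ∈ X) (hb' : G \ b ∈ Y) (hc : c ∈ X)
    (hc' : G \ c ∈ Y) (hbG : b ⊆ G) (hcG : c ⊆ G) (hbs' : b ≠ G \ s) (hcs' : c ≠ G \ s) (hbc : b ≠ c)
    (hw : s ∩ b = s ∩ c) (hwn : (s ∩ b).Nonempty) (hwL : s ∩ b ∈ monoMeets X Y) : 3 ≤ #(monoMeets X Y) := by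
  have hbc' : G \ b ≠ G \ c := fun e => hbc (by
    rw [← Finset.sdiff_sdiff_eq_self hbG, e, Finset.sdiff_sdiff_eq_self hcG])
  -- `b ∩ c ⊇ s ∩ b`
  have q1 : b ∩ c ∈ monoMeets X Y := inter_mem_monoMeets_left hb hc hbc
  by_cases h1 : b ∩ c ≠ s ∩ b
  · exact three_le_of_ne hwL q1 hwn (hwn.mono (subset_inter inter_subset_right (hw ▸ inter_subset_right))) h1.symm
  push Not at h1
  -- `(G ∖ s) ∩ b` is disjoint from `s ∩ b`
  have q2 : (G \ s) ∩ b ∈ monoMeets X Y := inter_mem_monoMeets_left hs' hb hbs'.symm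
  by_cases h2 : ((G \ s) ∩ b).Nonempty
  · exact three_le_of_disjoint hwL q2 hwn h2
      (disjoint_of_subset_left inter_subset_left (disjoint_of_subset_right inter_subset_left disjoint_sdiff))
  have q3 : (G \ s) ∩ c ∈ monoMeets X Y := inter_mem_monoMeets_left hs' hc hcs'.symm
  by_cases h3 : ((G \ s) ∩ c).Nonempty
  · exact three_le_of_disjoint hwL q3 hwn h3
      (disjoint_of_subset_left inter_subset_left (disjoint_of_subset_right inter_subset_left disjoint_sdiff))
  -- so `b, c ⊆ s`; the co-join `G ∖ (b ∪ c)` is disjoint from `s ∩ b`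
  rw [not_nonempty_iff_eq_empty] at h2 h3
  have hbs : b ⊆ s := by
    intro x hx; by_contra hxs
    have : x ∈ (G \ s) ∩ b := mem_inter.2 ⟨mem_sdiff.2 ⟨hbG hx, hxs⟩, hx⟩
    rw [h2] at this; exact notMem_empty _ this
  have hcs : c ⊆ s := by
    intro x hx; by_contra hxs
    have : x ∈ (G \ s) ∩ c := mem_inter.2 ⟨mem_sdiff.2 ⟨hcG hx, hxs⟩, hx⟩
    rw [h3] at this; exact notMem_empty _ this
  have q4 : (G \ b) ∩ (G \ c) ∈ monoMeets X Y := inter_mem_monoMeets_right hb' hc' hbc'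
  by_cases h4 : ((G \ b) ∩ (G \ c)).Nonempty
  · exact three_le_of_disjoint hwL q4 hwn h4
      (disjoint_of_subset_left inter_subset_right (disjoint_of_subset_right inter_subset_left disjoint_sdiff))
  -- `b ∪ c = G ⊆ s`, so `s ∩ b = b` and `s ∩ c = c`: `b = c`
  exfalso
  rw [not_nonempty_iff_eq_empty] at h4
  have hGbc : ∀ x ∈ G, x ∈ b ∨ x ∈ c := by
    intro x hx; by_contra h; push Not at h
    have : x ∈ (G \ b) ∩ (G \ c) := mem_inter.2 ⟨mem_sdiff.2 ⟨hx, h.1⟩, mem_sdiff.2 ⟨hx, h.2⟩⟩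
    rw [h4] at this; exact notMem_empty _ this
  apply hbc
  have e1 : s ∩ b = b := inter_eq_right.2 hbs
  have e2 : s ∩ c = c := inter_eq_right.2 hcs
  rw [← e1, ← e2]; exact hw

/-- **One constant pair and two split pairs** (`s, G∖s, b, c ∈ X`; `G∖b, G∖c ∈ Y`). [this work] -/
theorem three_le_t1 (hXY : Disjoint X Y) {s b c : Finset α} (hs : s ∈ X) (hs' : G \ s ∈ X) (hb : b ∈ X)
    (hb' : G \ b ∈ Y) (hc : c ∈ X) (hc' : G \ c ∈ Y) (hsG : s ⊆ G) (hbG : b ⊆ G) (hcG : c ⊆ G) (hbs : b ≠ s)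
    (hbs' : b ≠ G \ s) (hcs : c ≠ s) (hcs' : c ≠ G \ s) (hbc : b ≠ c) : 3 ≤ #(monoMeets X Y) := by
  have neXY : ∀ {u t : Finset α}, u ∈ X → t ∈ Y → u ≠ t := fun hu ht e => disjoint_left.1 hXY hu (e ▸ ht)
  have hbc' : G \ b ≠ G \ c := fun e => hbc (by
    rw [← Finset.sdiff_sdiff_eq_self hbG, e, Finset.sdiff_sdiff_eq_self hcG])
  have hss : G \ (G \ s) = s := Finset.sdiff_sdiff_eq_self hsG
  -- a split half equal to `∅`
  have zero : ∀ {b c : Finset α}, b ∈ X → G \ b ∈ Y → c ∈ X → G \ c ∈ Y → c ⊆ G → c ≠ s → c ≠ G \ s → b ≠ c →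
      G \ b ≠ G \ c → b = ∅ → 3 ≤ #(monoMeets X Y) := by
    intro b c hb hb' hc hc' hcG hcs hcs' hbc hbc' hb0
    have hc0 : c.Nonempty := nonempty_iff_ne_empty.2 (fun e => hbc (hb0.trans e.symm))
    obtain ⟨w, hw, hwn, hwc, -⟩ := exists_piece (Y := Y) hs hs' hc hcG hcs hcs' hc0
    have q := inter_mem_monoMeets_right (X := X) hb' hc' hbc'
    rw [hb0, sdiff_empty, inter_eq_right.2 sdiff_subset] at q
    have hc1 : (G \ c).Nonempty := nonempty_iff_ne_empty.2 (fun e => neXY hb hc' (hb0.trans e.symm))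
    exact three_le_of_disjoint hw q hwn hc1 (disjoint_of_subset_left hwc disjoint_sdiff)
  by_cases hb0 : b = ∅
  · exact zero hb hb' hc hc' hcG hcs hcs' hbc hbc' hb0
  by_cases hc0 : c = ∅
  · exact zero hc hc' hb hb' hbG hbs hbs' (Ne.symm hbc) (Ne.symm hbc') hc0
  obtain ⟨w, hw, hwn, hwb, ew⟩ := exists_piece (Y := Y) hs hs' hb hbG hbs hbs' (nonempty_iff_ne_empty.2 hb0)
  obtain ⟨w', hw', hwn', hwc, ew'⟩ := exists_piece (Y := Y) hs hs' hc hcG hcs hcs' (nonempty_iff_ne_empty.2 hc0)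
  by_cases hww : w ≠ w'
  · exact three_le_of_ne hw hw' hwn hwn' hww
  push Not at hww
  subst hww
  rcases ew with rfl | rfl <;> rcases ew' with e | e
  · exact three_le_t1_core hs' hb hb' hc hc' hbG hcG hbs' hcs' hbc e hwn hw
  · exfalso
    obtain ⟨x, hx⟩ := hwn
    have hx' := hx; rw [e] at hx'
    exact (mem_sdiff.1 (mem_inter.1 hx').1).2 (mem_inter.1 hx).1
  · exfalso
    obtain ⟨x, hx⟩ := hwn
    have hx' := hx; rw [e] at hx'
    exact (mem_sdiff.1 (mem_inter.1 hx).1).2 (mem_inter.1 hx').1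
  · exact three_le_t1_core (s := G \ s) (hss.symm ▸ hs) hb hb' hc hc' hbG hcG (hss.symm ▸ hbs)
      (hss.symm ▸ hcs) hbc e hwn hw

/-- The same with the classes swapped. [this work] -/
theorem three_le_t1' (hXY : Disjoint X Y) {s b c : Finset α} (hs : s ∈ Y) (hs' : G \ s ∈ Y) (hb : b ∈ Y)
    (hb' : G \ b ∈ X) (hc : c ∈ Y) (hc' : G \ c ∈ X) (hsG : s ⊆ G) (hbG : b ⊆ G) (hcG : c ⊆ G) (hbs : b ≠ s)
    (hbs' : b ≠ G \ s) (hcs : c ≠ s) (hcs' : c ≠ G \ s) (hbc : b ≠ c) : 3 ≤ #(monoMeets X Y) := by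
  rw [monoMeets_comm]; exact three_le_t1 hXY.symm hs hs' hb hb' hc hc' hsG hbG hcG hbs hbs' hcs hcs' hbc

/-- Core of the all-split case (the rainbow configuration of three sets) when `a ∩ b` is non-empty. [this work] -/
theorem three_le_t0_core (hXY : Disjoint X Y) {a b c : Finset α} (ha : a ∈ X) (hb : b ∈ X) (hc : c ∈ X)
    (ha' : G \ a ∈ Y) (hb' : G \ b ∈ Y) (hc' : G \ c ∈ Y) (haG : a ⊆ G) (hbG : b ⊆ G) (hcG : c ⊆ G) (hab : a ≠ b)
    (hac : a ≠ c) (hbc : b ≠ c) (hw : (a ∩ b).Nonempty) : 3 ≤ #(monoMeets X Y) := by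
  have neXY : ∀ {u t : Finset α}, u ∈ X → t ∈ Y → u ≠ t := fun hu ht e => disjoint_left.1 hXY hu (e ▸ ht)
  have cne : ∀ {u t : Finset α}, u ⊆ G → t ⊆ G → u ≠ t → G \ u ≠ G \ t := fun hu ht h e => h (by
    rw [← Finset.sdiff_sdiff_eq_self hu, e, Finset.sdiff_sdiff_eq_self ht])
  have qab := inter_mem_monoMeets_left (Y := Y) ha hb hab
  have jab := inter_mem_monoMeets_right (X := X) ha' hb' (cne haG hbG hab)
  have qac := inter_mem_monoMeets_left (Y := Y) ha hc hac
  have jac := inter_mem_monoMeets_right (X := X) ha' hc' (cne haG hcG hac)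
  have djw : ∀ {t : Finset α}, Disjoint (a ∩ b) ((G \ a) ∩ t) := fun {t} =>
    disjoint_of_subset_left inter_subset_left (disjoint_of_subset_right inter_subset_left disjoint_sdiff)
  by_cases h1 : ((G \ a) ∩ (G \ b)).Nonempty
  · exact three_le_of_disjoint qab jab hw h1 djw
  by_cases h2 : ((G \ a) ∩ (G \ c)).Nonempty
  · exact three_le_of_disjoint qab jac hw h2 djw
  by_cases h3 : (a ∩ c).Nonempty ∧ a ∩ c ≠ a ∩ b
  · exact three_le_of_ne qab qac hw h3.1 h3.2.symm
  exfalso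
  rw [not_nonempty_iff_eq_empty] at h1 h2
  have cov : ∀ {t : Finset α}, (G \ a) ∩ (G \ t) = ∅ → ∀ x ∈ G, x ∉ a → x ∈ t := by
    intro t h x hx hxa; by_contra hxt
    have : x ∈ (G \ a) ∩ (G \ t) := mem_inter.2 ⟨mem_sdiff.2 ⟨hx, hxa⟩, mem_sdiff.2 ⟨hx, hxt⟩⟩
    rw [h] at this; exact notMem_empty _ this
  rw [not_and_or, not_nonempty_iff_eq_empty, not_not] at h3
  rcases h3 with h3 | h3
  · -- `a ∩ c = ∅` and `a ∪ c = G`: `c = G ∖ a`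
    apply neXY hc ha'
    ext x; simp only [mem_sdiff]
    constructor
    · intro hx; exact ⟨hcG hx, fun hxa => by
        have : x ∈ a ∩ c := mem_inter.2 ⟨hxa, hx⟩
        rw [h3] at this; exact notMem_empty _ this⟩
    · rintro ⟨hxG, hxa⟩; exact cov h2 x hxG hxa
  · -- `a ∩ c = a ∩ b` and both unions are `G`: `b = c`
    apply hbc
    ext x
    by_cases hxa : x ∈ a
    · have := congrArg (x ∈ ·) h3
      simp only [mem_inter, eq_iff_iff] at this
      constructor
      · intro hx; exact (this.2 ⟨hxa, hx⟩).2
      · intro hx; exact (this.1 ⟨hxa, hx⟩).2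
    · constructor
      · intro hx; exact cov h2 x (hbG hx) hxa
      · intro hx; exact cov h1 x (hcG hx) hxa

/-- **Three split pairs** (`a, b, c ∈ X`, `G∖a, G∖b, G∖c ∈ Y`): the rainbow lemma for three sets. [this work] -/
theorem three_le_t0 (hXY : Disjoint X Y) {a b c : Finset α} (ha : a ∈ X) (hb : b ∈ X) (hc : c ∈ X)
    (ha' : G \ a ∈ Y) (hb' : G \ b ∈ Y) (hc' : G \ c ∈ Y) (haG : a ⊆ G) (hbG : b ⊆ G) (hcG : c ⊆ G) (hab : a ≠ b)
    (hac : a ≠ c) (hbc : b ≠ c) : 3 ≤ #(monoMeets X Y) := by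
  by_cases hw : (a ∩ b).Nonempty
  · exact three_le_t0_core hXY ha hb hc ha' hb' hc' haG hbG hcG hab hac hbc hw
  · -- then the co-join `(G ∖ a) ∩ (G ∖ b)` is non-empty: use the classes swapped
    have cne : ∀ {u t : Finset α}, u ⊆ G → t ⊆ G → u ≠ t → G \ u ≠ G \ t := fun hu ht h e => h (by
      rw [← Finset.sdiff_sdiff_eq_self hu, e, Finset.sdiff_sdiff_eq_self ht])
    have hw' : ((G \ a) ∩ (G \ b)).Nonempty := by
      rw [not_nonempty_iff_eq_empty] at hw
      by_contra h; rw [not_nonempty_iff_eq_empty] at h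
      apply disjoint_left.1 hXY hb
      have : b = G \ a := by
        ext x; simp only [mem_sdiff]
        constructor
        · intro hx; refine ⟨hbG hx, fun hxa => ?_⟩
          have : x ∈ a ∩ b := mem_inter.2 ⟨hxa, hx⟩
          rw [hw] at this; exact notMem_empty _ this
        · rintro ⟨hxG, hxa⟩; by_contra hxb
          have : x ∈ (G \ a) ∩ (G \ b) := mem_inter.2 ⟨mem_sdiff.2 ⟨hxG, hxa⟩, mem_sdiff.2 ⟨hxG, hxb⟩⟩
          rw [h] at this; exact notMem_empty _ this
      rw [this]; exact ha'
    rw [monoMeets_comm]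
    have e : ∀ {u : Finset α}, u ⊆ G → G \ (G \ u) = u := fun hu => Finset.sdiff_sdiff_eq_self hu
    exact three_le_t0_core hXY.symm ha' hb' hc' ((e haG).symm ▸ ha) ((e hbG).symm ▸ hb) ((e hcG).symm ▸ hc)
      sdiff_subset sdiff_subset sdiff_subset (cne haG hbG hab) (cne haG hcG hac) (cne hbG hcG hbc) hw'


end Small3

end Summit.CriticalPhenomena.PercolationContinuityZ3.Theorems.SahiColouredDaykin
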